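import Mathlib
import Literature.Analysis.FluidPDE.Tao2016AveragedNS.CascadeTableDictionary
import Summits.NavierStokesRegularity.NavierStokesRegularity.Theorems.WakeRatchetAdmissibleEternalBoundPersistence
import HarnessLib

/-!
# `AdmissibleEternalBound` for the DYADIC member: every admissible eternal solution of `dyadicTable` is
# NON-NEGATIVE, hence a forward cascade; inviscidly it is therefore uniformly bounded
# (support for `WakeRatchet.AdmissibleEternalBound`, stmt-NavierStokesRegularity-23197)

For the dyadic (Katz–Pavlović / Cheskidov) member `dyadicTable ∈ E₂(2)` of Tao's table class the crux
`WakeRatchet.AdmissibleEternalBound` is settled on the inviscid slice, for EVERY `ε₀ > 0`: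

* `dyadic_hasDerivAt_apply` — the renormalised law componentwise: component `0` is the scalar chain
  `w_n' = −(1+ν̂_n)w_n + Λw_{n-1}² − Λ⁻¹w_nw_{n+1}`, the other components are purely damped;
* `dyadic_apply_ne_zero` — the other components of an ADMISSIBLE solution vanish (a damped mode that is
  integrable in log-time is zero);
* `dyadic_nonneg` — `w_n ≥ 0`: a negative value propagates backwards with at most the Grönwall loss
  `e^{-M/Λ}` (M = per-shell action), contradicting integrability — so admissible ETERNAL solutions of the
  dyadic member are non-negative outright (compare Barbato–Morandin, NoDEA 2013: forward solutions become
  positive);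
* `dyadic_physFlux_nonneg` — hence all energy fluxes are `≥ 0` (forward cascade);
* `uniformBound_dyadic`, `norm_le_dyadic`, `admissibleEternalBound_dyadic_inviscid` — by energy
  persistence (`WakeRatchetPersistence.uniformBound_of_forwardCascade`) every admissible INVISCID eternal
  solution of the dyadic member is `UniformBound`, `‖W_k(σ)‖ ≤ M e^{C_A M/Λ}`;
* `norm_le_dyadic_visc` — with covariant viscosity the same bound holds up to the factor
  `e^{viscCoef(b,σ₀)}` (uniform at and below the dissipation cutoff; the hot layer under the cutoff is
  what remains, cf. `WakeRatchetAdmissibleEternalBoundDissipativeStep`).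

MODEL lattice ODEs only (Tao 2016 §1.2, §4, §6.4); nothing here is a statement about the Navier–Stokes
equations, and no summit or rung is proved.
-/

noncomputable section

set_option linter.dupNamespace false

namespace Summit.NavierStokesRegularity.NavierStokesRegularity.Theorems

namespace WakeRatchetDyadic

open Filter Topology MeasureTheory Set intervalIntegral
open scoped RealInnerProductSpace
open Literature.Analysis.FluidPDE Literature.Analysis.FluidPDE.TaoCascade
open WakeRatchetFedSpike WakeRatchetPersistence

section Dyadic

variable {ε₀ νh : ℝ} {W : ℤ → ℝ → Em 4}

/-- **The lattice law of the dyadic member, componentwise.**  For an admissible eternal solution of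
`dyadicTable` (any covariant viscosity `ν̂ ≥ 0`): component `0` obeys the Katz–Pavlović / Cheskidov
chain `w_n' = −(1+ν̂_n)w_n + Λ w_{n-1}² − Λ⁻¹ w_n w_{n+1}` in log-time, and every other component obeys
the pure damping `u' = −(1+ν̂_n)u`.
[cite: Tao2016AveragedNS, §1.2 (the dyadic model), §4 (4.1), Lemma 4.1 (4.8), §6.4; cell vocabulary (`dyadicTable`, `IsEternalVisc`)] -/
theorem dyadic_hasDerivAt_apply (hW : IsEternalVisc ε₀ νh dyadicTable W) (n : ℤ) (σ : ℝ) (i : Fin 4) :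
    HasDerivAt (fun s => W n s i)
      ((if i = 0 then bigLam ε₀ * (W (n - 1) σ 0 * W (n - 1) σ 0)
          - (bigLam ε₀)⁻¹ * (W n σ 0 * W (n + 1) σ 0) else 0)
        - (1 + viscCoef ε₀ νh n σ) * W n σ i) σ := by
  have hq : ∀ (μ : ℤ × ℤ × ℤ) (y x : Em 4) (j : Fin 4),
      qform dyadicTable μ y x j = if j = 0 then dyadicTable 0 0 0 μ * (y 0 * x 0) else 0 := by
    intro μ y x j
    unfold qform
    split_ifs with hj
    · subst hj
      rw [Fintype.sum_eq_single (0 : Fin 4) (fun i₁ hi₁ => Finset.sum_eq_zero fun i₂ _ => by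
          have : ¬ (i₁ = 0 ∧ i₂ = 0 ∧ (0 : Fin 4) = 0) := fun h => hi₁ h.1
          simp [dyadicTable_of_not this])]
      rw [Fintype.sum_eq_single (0 : Fin 4) (fun i₂ hi₂ => by
          have : ¬ ((0 : Fin 4) = 0 ∧ i₂ = 0 ∧ (0 : Fin 4) = 0) := fun h => hi₂ h.2.1
          simp [dyadicTable_of_not this])]
    · refine Finset.sum_eq_zero fun i₁ _ => Finset.sum_eq_zero fun i₂ _ => ?_
      have : ¬ (i₁ = 0 ∧ i₂ = 0 ∧ j = 0) := fun h => hj h.2.2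
      simp [dyadicTable_of_not this]
  have h := (PiLp.proj 2 (𝕜 := ℝ) (fun _ : Fin 4 => ℝ) i).hasFDerivAt.comp_hasDerivAt σ (hW.law n σ)
  have e : (PiLp.proj 2 (𝕜 := ℝ) (fun _ : Fin 4 => ℝ) i)
      (-((1 : ℝ) • W n σ) + tableQ dyadicTable (W n σ) + bigLam ε₀ • tableA dyadicTable (W (n - 1) σ)
        + (bigLam ε₀)⁻¹ • tableB dyadicTable (W (n + 1) σ) (W n σ)
        - (νh * ((1 + ε₀) ^ ((2 : ℝ) * n) * Real.exp (-σ))) • W n σ)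
      = (if i = 0 then bigLam ε₀ * (W (n - 1) σ 0 * W (n - 1) σ 0)
          - (bigLam ε₀)⁻¹ * (W n σ 0 * W (n + 1) σ 0) else 0)
        - (1 + viscCoef ε₀ νh n σ) * W n σ i := by
    simp only [PiLp.proj_apply, PiLp.sub_apply, PiLp.add_apply, PiLp.neg_apply, PiLp.smul_apply,
      smul_eq_mul, tableQ_apply, tableA_apply, tableB_apply, hq]
    unfold viscCoef
    split_ifs with hi
    · subst hi
      simp [dyadicTable]
      ring
    · ring
  rw [e] at h
  exact h

/-- The primitive of the damping rate: `P(s) = s − ν̂(1+ε₀)^{2n}e^{-s}` has `P' = 1 + viscCoef(n, s)`.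
[cite: Tao2016AveragedNS, §4, the viscous equation before Thm. 4.2, §6.4; cell vocabulary (`viscCoef`)] -/
theorem hasDerivAt_dampingPrimitive (ε₀ νh : ℝ) (n : ℤ) (s : ℝ) :
    HasDerivAt (fun s => s - νh * (1 + ε₀) ^ ((2 : ℝ) * n) * Real.exp (-s))
      (1 + viscCoef ε₀ νh n s) s := by
  have h1 : HasDerivAt (fun s : ℝ => Real.exp (-s)) (Real.exp (-s) * (-1 : ℝ)) s :=
    (hasDerivAt_neg s).exp
  have h2 := (hasDerivAt_id s).sub (h1.const_mul (νh * (1 + ε₀) ^ ((2 : ℝ) * n)))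
  refine h2.congr_deriv ?_
  unfold viscCoef
  ring

/-- **Off-diagonal components vanish.**  For an admissible eternal solution of the dyadic member, every
component `i ≠ 0` is identically zero: it solves the pure damping `u' = −(1+ν̂_n)u`, so `u·e^{P}` is
constant (`P' = 1 + ν̂_n`), i.e. `|u(s)| = |C|e^{-P(s)} ≥ |C|` for `s ≤ 0` — incompatible with the
integrability of `‖W_n‖` unless `C = 0`.
[cite: Tao2016AveragedNS, §1.2, §4 Lemma 4.1 (4.8), §6.4; cell vocabulary] -/
theorem dyadic_apply_ne_zero (hε : 0 < ε₀) (hW : IsEternalVisc ε₀ νh dyadicTable W) (n : ℤ)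
    {i : Fin 4} (hi : i ≠ 0) (σ : ℝ) : W n σ i = 0 := by
  set K : ℝ := νh * (1 + ε₀) ^ ((2 : ℝ) * n) with hKdef
  have hx : 0 < 1 + ε₀ := by linarith
  have hK : 0 ≤ K := mul_nonneg hW.nonneg (Real.rpow_nonneg hx.le _)
  set P : ℝ → ℝ := fun s => s - K * Real.exp (-s) with hPdef
  have hP : ∀ s, HasDerivAt P (1 + viscCoef ε₀ νh n s) s := fun s =>
    hasDerivAt_dampingPrimitive ε₀ νh n s
  have hu : ∀ s, HasDerivAt (fun s => W n s i) (-(1 + viscCoef ε₀ νh n s) * W n s i) s := by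
    intro s
    have := dyadic_hasDerivAt_apply hW n s i
    simp only [if_neg hi, zero_sub] at this
    exact this.congr_deriv (by ring)
  have hφ : ∀ s, HasDerivAt (fun s => W n s i * Real.exp (P s)) 0 s := by
    intro s
    have := (hu s).mul (hP s).exp
    exact this.congr_deriv (by ring)
  have hconst := is_const_of_deriv_eq_zero (f := fun s => W n s i * Real.exp (P s))
    (fun s => (hφ s).differentiableAt) (fun s => (hφ s).deriv)
  set C : ℝ := W n 0 i * Real.exp (P 0) with hCdef
  have hrep : ∀ s, W n s i = C * Real.exp (-(P s)) := by
    intro s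
    have h1 : W n s i * Real.exp (P s) = C := hconst s 0
    have h2 : Real.exp (P s) * Real.exp (-(P s)) = 1 := by rw [← Real.exp_add]; simp
    calc W n s i = W n s i * (Real.exp (P s) * Real.exp (-(P s))) := by rw [h2, mul_one]
      _ = C * Real.exp (-(P s)) := by rw [← mul_assoc, h1]
  -- `C = 0`, by integrability of `‖W_n‖`
  have hC : C = 0 := by
    by_contra hC
    have hCpos : 0 < |C| := abs_pos.2 hC
    obtain ⟨a, ha0, ha⟩ := exists_le_abs_lt (hW.action.choose_spec n).1 hCpos 0
    rw [abs_of_nonneg (norm_nonneg _)] at ha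
    have h1 : |W n a i| ≤ ‖W n a‖ := by
      have := PiLp.norm_apply_le (W n a) i
      rwa [Real.norm_eq_abs] at this
    have hPa : -(P a) ≥ 0 := by
      simp only [hPdef]
      have : 0 ≤ K * Real.exp (-a) := mul_nonneg hK (Real.exp_pos _).le
      linarith
    have h2 : |C| ≤ |W n a i| :=
      calc |C| ≤ |C| * Real.exp (-(P a)) :=
            le_mul_of_one_le_right (abs_nonneg C) (Real.one_le_exp hPa)
        _ = |W n a i| := by
            rw [hrep a, abs_mul C (Real.exp (-(P a))), abs_of_pos (Real.exp_pos _)]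
    linarith
  rw [hrep σ, hC, zero_mul]

/-- **NON-NEGATIVITY.**  Every admissible eternal solution of the dyadic member (any covariant
viscosity `ν̂ ≥ 0`, any `ε₀ > 0`) has `W_{n,0}(σ) ≥ 0` for all `n, σ`.  Mechanism: with
`E = exp(P + Λ⁻¹∫_{σ₁} w_{n+1})`, the product `w_n·E` has derivative `E·Λ w_{n-1}² ≥ 0`; a negative
value `w_n(σ₁) = −δ` therefore propagates BACKWARDS as `w_n(s) ≤ −δ e^{-M/Λ}` for all `s ≤ σ₁` (the
action of shell `n+1` bounds the Grönwall factor) — incompatible with the integrability of `‖W_n‖`.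
Compare Barbato–Morandin (NoDEA 2013): forward solutions of the dyadic model become positive; for
ETERNAL admissible solutions negativity is excluded outright.  MODEL lattice only.
[cite: Tao2016AveragedNS, §1.2 (dyadic model), §4 Lemma 4.1 (4.8), §6.4; cell vocabulary (`dyadicTable`, `IsEternalVisc`)] -/
theorem dyadic_nonneg (hε : 0 < ε₀) (hW : IsEternalVisc ε₀ νh dyadicTable W) (n : ℤ) (σ₁ : ℝ) :
    0 ≤ W n σ₁ 0 := by
  by_contra hneg
  push Not at hneg
  set δ : ℝ := -(W n σ₁ 0) with hδdef
  have hδ : 0 < δ := by rw [hδdef]; linarith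
  obtain ⟨M, hM⟩ := hW.action
  have hM0 : 0 ≤ M := le_trans (integral_nonneg fun _ => norm_nonneg _) (hM 0).2
  have hΛpos : 0 < bigLam ε₀ := bigLam_pos (by linarith)
  have hΛi : 0 ≤ (bigLam ε₀)⁻¹ := inv_nonneg.2 hΛpos.le
  set K : ℝ := νh * (1 + ε₀) ^ ((2 : ℝ) * n) with hKdef
  have hx : 0 < 1 + ε₀ := by linarith
  have hK : 0 ≤ K := mul_nonneg hW.nonneg (Real.rpow_nonneg hx.le _)
  set P : ℝ → ℝ := fun s => s - K * Real.exp (-s) with hPdef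
  have hP : ∀ s, HasDerivAt P (1 + viscCoef ε₀ νh n s) s := fun s =>
    hasDerivAt_dampingPrimitive ε₀ νh n s
  -- the three scalar components and their laws
  have hw : ∀ s, HasDerivAt (fun s => W n s 0)
      (bigLam ε₀ * (W (n - 1) s 0 * W (n - 1) s 0) - (bigLam ε₀)⁻¹ * (W n s 0 * W (n + 1) s 0)
        - (1 + viscCoef ε₀ νh n s) * W n s 0) s := by
    intro s
    have := dyadic_hasDerivAt_apply hW n s 0
    rw [if_pos rfl] at this
    exact this
  have hwc1 : Continuous fun s => W (n + 1) s 0 :=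
    continuous_iff_continuousAt.2 fun s => (dyadic_hasDerivAt_apply hW (n + 1) s 0).continuousAt
  -- `I(s) = ∫_{σ₁}^{s} w_{n+1}`
  set I : ℝ → ℝ := fun s => ∫ t in σ₁..s, W (n + 1) t 0 with hIdef
  have hI : ∀ s, HasDerivAt I (W (n + 1) s 0) s := fun s =>
    intervalIntegral.integral_hasDerivAt_right (hwc1.intervalIntegrable _ _)
      (hwc1.stronglyMeasurableAtFilter _ _) hwc1.continuousAt
  have hIbd : ∀ s, s ≤ σ₁ → I s ≤ M := by
    intro s hs
    have e : I s = ∫ t in s..σ₁, -(W (n + 1) t 0) := by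
      simp only [hIdef]; rw [intervalIntegral.integral_symm, intervalIntegral.integral_neg]
    rw [e]
    have h1 : ∫ t in s..σ₁, -(W (n + 1) t 0) ≤ ∫ t in s..σ₁, ‖W (n + 1) t‖ :=
      intervalIntegral.integral_mono_on hs (hwc1.neg.intervalIntegrable _ _)
        ((continuous_iff_continuousAt.2 fun x => (hW.law (n + 1) x).continuousAt).norm.intervalIntegrable
          _ _)
        (fun t _ => by
          have h := PiLp.norm_apply_le (W (n + 1) t) 0
          rw [Real.norm_eq_abs] at h
          exact (neg_le_abs _).trans h)
    exact h1.trans ((intervalIntegral_le_integral (hM (n + 1)).1 (fun _ => norm_nonneg _) hs).trans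
      (hM (n + 1)).2)
  -- `φ = w · exp(P + Λ⁻¹ I)` is monotone
  have hPI : ∀ s, HasDerivAt (fun x => P x + (bigLam ε₀)⁻¹ * I x)
      (1 + viscCoef ε₀ νh n s + (bigLam ε₀)⁻¹ * W (n + 1) s 0) s := by
    intro s
    have h1 := hP s
    have h2 := (hI s).const_mul (bigLam ε₀)⁻¹
    exact h1.add h2
  set φ : ℝ → ℝ := fun s => W n s 0 * Real.exp (P s + (bigLam ε₀)⁻¹ * I s) with hφdef
  have hφd : ∀ s, HasDerivAt φ (Real.exp (P s + (bigLam ε₀)⁻¹ * I s) *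
      (bigLam ε₀ * (W (n - 1) s 0 * W (n - 1) s 0))) s := by
    intro s
    have h3 : HasDerivAt (fun x => Real.exp (P x + (bigLam ε₀)⁻¹ * I x))
        (Real.exp (P s + (bigLam ε₀)⁻¹ * I s)
          * (1 + viscCoef ε₀ νh n s + (bigLam ε₀)⁻¹ * W (n + 1) s 0)) s := (hPI s).exp
    have := (hw s).mul h3
    exact this.congr_deriv (by ring)
  have hφmono : Monotone φ := by
    refine monotone_of_deriv_nonneg (fun s => (hφd s).differentiableAt) fun s => ?_
    rw [(hφd s).deriv]
    have : 0 ≤ W (n - 1) s 0 * W (n - 1) s 0 := mul_self_nonneg _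
    positivity
  -- backwards propagation of negativity
  have hback : ∀ s, s ≤ σ₁ → δ * Real.exp (-(M * (bigLam ε₀)⁻¹)) ≤ ‖W n s‖ := by
    intro s hs
    have h1 : φ s ≤ φ σ₁ := hφmono hs
    have hIσ₁ : I σ₁ = 0 := by simp only [hIdef, intervalIntegral.integral_same]
    have eφ1 : φ σ₁ = -δ * Real.exp (P σ₁) := by
      simp only [hφdef, hIσ₁, mul_zero, add_zero, hδdef, neg_neg]
    have hPcmp : P s ≤ P σ₁ := by
      simp only [hPdef]
      have : Real.exp (-σ₁) ≤ Real.exp (-s) := Real.exp_le_exp.2 (by linarith)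
      nlinarith
    -- from `φ s ≤ φ σ₁ < 0`: `w s ≤ -δ exp(P σ₁ - P s - Λ⁻¹ I s) ≤ -δ e^{-M/Λ}`
    have hEs : 0 < Real.exp (P s + (bigLam ε₀)⁻¹ * I s) := Real.exp_pos _
    have hws : W n s 0 ≤ -δ * Real.exp (P σ₁ - (P s + (bigLam ε₀)⁻¹ * I s)) := by
      have h2 : W n s 0 * Real.exp (P s + (bigLam ε₀)⁻¹ * I s) ≤ -δ * Real.exp (P σ₁) := by
        rw [← eφ1]; exact h1
      have h3 : -δ * Real.exp (P σ₁)
          = (-δ * Real.exp (P σ₁ - (P s + (bigLam ε₀)⁻¹ * I s))) *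
            Real.exp (P s + (bigLam ε₀)⁻¹ * I s) := by
        rw [mul_assoc, ← Real.exp_add]; ring_nf
      rw [h3] at h2
      exact le_of_mul_le_mul_right h2 hEs
    have hexp2 : Real.exp (-(M * (bigLam ε₀)⁻¹))
        ≤ Real.exp (P σ₁ - (P s + (bigLam ε₀)⁻¹ * I s)) := by
      refine Real.exp_le_exp.2 ?_
      have := mul_le_mul_of_nonneg_left (hIbd s hs) hΛi
      linarith
    have hws' : W n s 0 ≤ -(δ * Real.exp (-(M * (bigLam ε₀)⁻¹))) := by
      have := mul_le_mul_of_nonneg_left hexp2 hδ.le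
      linarith
    have habs : δ * Real.exp (-(M * (bigLam ε₀)⁻¹)) ≤ |W n s 0| := by
      rw [abs_of_nonpos (by
        have : 0 ≤ δ * Real.exp (-(M * (bigLam ε₀)⁻¹)) := by positivity
        linarith)]
      linarith
    have hcoord : |W n s 0| ≤ ‖W n s‖ := by
      have h := PiLp.norm_apply_le (W n s) 0
      rwa [Real.norm_eq_abs] at h
    exact habs.trans hcoord
  -- contradiction with integrability
  have hη : 0 < δ * Real.exp (-(M * (bigLam ε₀)⁻¹)) := by positivity
  obtain ⟨a, ha, hlt⟩ := exists_le_abs_lt (hM n).1 hη σ₁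
  rw [abs_of_nonneg (norm_nonneg _)] at hlt
  exact absurd (hback a ha) (not_le.2 hlt)

/-- **Admissible eternal solutions of the dyadic member are forward cascades**: every energy flux
`F_k ∝ W_{k+1,0} W_{k,0}²` is non-negative.
[cite: Tao2016AveragedNS, §1.2, §4 Lemma 4.1 (4.9); cell vocabulary (`physFlux`)] -/
theorem dyadic_physFlux_nonneg (hε : 0 < ε₀) (hW : IsEternalVisc ε₀ νh dyadicTable W) (k : ℤ)
    (σ : ℝ) : 0 ≤ physFlux ε₀ dyadicTable W k σ := by
  have hΛ : 0 < bigLam ε₀ := bigLam_pos (by linarith)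
  have hz : 0 < (bigLam ε₀ ^ k)⁻¹ ^ 2 * (bigLam ε₀)⁻¹ := by
    have := zpow_pos hΛ k
    positivity
  unfold physFlux
  rw [inner_tableA_dyadicTable]
  have : 0 ≤ W k σ 0 * W k σ 0 * W (k + 1) σ 0 :=
    mul_nonneg (mul_self_nonneg _) (dyadic_nonneg hε hW (k + 1) σ)
  positivity

/-- **`AdmissibleEternalBound` for the INVISCID DYADIC member — unconditionally.**  Every admissible
inviscid eternal solution of `dyadicTable` (any `ε₀ > 0`) is uniformly bounded, with constant
`M e^{C_A M/Λ}` (`norm_le_dyadic`): non-negativity (`dyadic_nonneg`) makes it a forward cascade, and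
energy persistence (`WakeRatchetPersistence.uniformBound_of_forwardCascade`) bounds forward cascades.
This settles the crux `WakeRatchet.AdmissibleEternalBound` (stmt-23197) on the slice
`{α = dyadicTable, ν̂ = 0}` with no threshold on `ε₀`.  MODEL lattice only; nothing about NS.
[cite: Tao2016AveragedNS, §1.2 (dyadic model), §4 Thm. 4.2 (statement shape), §6.4; cell vocabulary (`dyadicTable`, `IsEternal`, `UniformBound`)] -/
theorem uniformBound_dyadic (hε : 0 < ε₀) (hW : IsEternal ε₀ dyadicTable W) : UniformBound W :=
  uniformBound_of_forwardCascade hε dyadicTable_cancelling hW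
    (dyadic_physFlux_nonneg hε hW.isEternalVisc)

/-- Explicit constant for the inviscid dyadic member: `‖W_k(σ)‖ ≤ M e^{C_A M/Λ}` for any per-shell
action bound `M`. [cite: Tao2016AveragedNS, §1.2, §4, §6.4; cell vocabulary] -/
theorem norm_le_dyadic (hε : 0 < ε₀) (hW : IsEternal ε₀ dyadicTable W)
    {M : ℝ} (hM : ∀ n : ℤ, Integrable (fun σ => ‖W n σ‖) ∧ ∫ σ, ‖W n σ‖ ≤ M) (k : ℤ) (σ : ℝ) :
    ‖W k σ‖ ≤ M * Real.exp (fluxConst dyadicTable * (bigLam ε₀)⁻¹ * M) :=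
  norm_le_of_forwardCascade hε dyadicTable_cancelling hW hM
    (dyadic_physFlux_nonneg hε hW.isEternalVisc) k σ

/-- **Viscous dyadic member: the bound at and below the dissipation cutoff.**  For every admissible
eternal solution of `dyadicTable` with covariant viscosity `ν̂ ≥ 0` and per-shell action `≤ M`:
`‖W_b(σ₀)‖ ≤ M exp(C_A M/Λ + viscCoef(b, σ₀))` at every shell and log-time (all edges are forward by
`dyadic_physFlux_nonneg`); uniform wherever `viscCoef(b,σ₀) = ν̂(1+ε₀)^{2b}e^{-σ₀}` is bounded — the
hot layer under the cutoff is what remains (see `WakeRatchetAdmissibleEternalBoundDissipativeStep`).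
[cite: Tao2016AveragedNS, §1.2, §4, the viscous equation before Thm. 4.2, §6.4; cell vocabulary] -/
theorem norm_le_dyadic_visc (hε : 0 < ε₀) (hW : IsEternalVisc ε₀ νh dyadicTable W)
    {M : ℝ} (hM : ∀ n : ℤ, Integrable (fun σ => ‖W n σ‖) ∧ ∫ σ, ‖W n σ‖ ≤ M) (b : ℤ) (σ₀ : ℝ) :
    ‖W b σ₀‖ ≤ M * Real.exp (fluxConst dyadicTable * (bigLam ε₀)⁻¹ * M + viscCoef ε₀ νh b σ₀) :=
  norm_le_of_forwardFlux hε dyadicTable_cancelling hW hM b σ₀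
    (fun σ _ => dyadic_physFlux_nonneg hε hW (b - 1) σ)

end Dyadic

/-- **The crux on the slice `{α = dyadicTable, ν̂ = 0}`, in its own quantifier shape** (with the table
fixed and no threshold): for every `ε₀ > 0`, every admissible inviscid eternal solution of the dyadic
member is `UniformBound`.  (`dyadicTable ∈ InTableClass R` for `R ≥ 2`: `inTableClass_dyadicTable`.)
MODEL lattice only; nothing about the Navier–Stokes equations; no summit or rung is proved.
[cite: Tao2016AveragedNS, §1.2, §4 Thm. 4.2 (statement shape), §6.4; cell vocabulary] -/
theorem admissibleEternalBound_dyadic_inviscid :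
    ∀ ε₀ : ℝ, 0 < ε₀ → ∀ W : ℤ → ℝ → Em 4, IsEternal ε₀ dyadicTable W → UniformBound W :=
  fun _ε₀ hε _W hW => uniformBound_dyadic hε hW

end WakeRatchetDyadic

end Summit.NavierStokesRegularity.NavierStokesRegularity.Theorems

end
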